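import Summits.HodgeConjecture.HodgeConjecture.Theorems.Ring2AbelianAllAndreSporadicClassesGoodFibres
import Summits.HodgeConjecture.HodgeConjecture.Theorems.Ring2AbelianAllSpreadHodgeInputPivots
import HarnessLib

/-!
# Ring 2 · sub-cell AbelianAll (ALL ABELIAN VARIETIES), André axis, part XXXI-f — SPORADIC ALGEBRAIC CLASSES, THE KIND COLUMN
# CERTIFIED: "uncountably many good fibres on every CM-pointed compact pencil of abelian varieties" (Good_ℵ) IMPLIES `HC_CM` BY ITSELF
# (constant pencils `A × E₀ ⟶ E₀`, seat ab-spread-1's method of part XXXI), hence is a PIVOT: `HC_AV ⟺ Good_ℵ` modulo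
# [Lemme 6.3.1, Verdier] — as announced in the honest column of part XXXI-d; the `HC_CM`-idle form remains (4_ℵ) of part XXXI-b

HONEST FRAMING (page 1, verbatim): **research route, not a corollary; conditional on HC_CM plus one named
minimal statement.** Cell line: research route conditional on HC_CM; not a corollary; Q11.4-sentence-2 already
refuted in dim ≥ 3. Nothing in this file proves a case of the Hodge conjecture for an abelian variety: Good_ℵ is a
HYPOTHESIS wherever it occurs (displayed inline, NO `def`, no node born); `HC_CM` (`Theses.RankFourFaces.CMAbelianHodge`)
is here a CONCLUSION of Good_ℵ or a conjunct, never a fact; `h₂₁` (Lemme 6.3.1) and `hGT` (Verdier) are NAMED-FACT BINDERS;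
the reduction item `CMToAbelian` (stmt-HodgeConjecture-16267) is NOT closed; `B_min` of record (N104) untouched; nothing is
claimed minimal. KIND (census): Good_ℵ is KIND 1 (a pivot, idle = NO: it contains `HC_CM`), exactly like the Hodge-input faces
F₁–F₄ graded by ab-spread-1's part XXXI; the André-axis `HC_CM`-idle complements are the ALGEBRAIC-input forms, here (4_ℵ).

## Content

Good_ℵ := "for every compact pencil `f` of abelian `d`-folds with a CM fibre and every `p`, the set of `p`-GOOD fibres — those
`s` at which every global class with rational `(p,p)` fibre restrictions is algebraic — is NOT countable".
* §1 **`HC_CM_of_forall_not_countable_good`** — Good_ℵ ⟹ `HC_CM`, NO named fact: for a CM abelian variety `A` and a rational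
  `(p,p)` class `c`, the constant pencil `A × E₀ ⟶ E₀` (`E₀` the tree's CM elliptic curve; `isCompactAbelianPencil_snd`) is
  CM-pointed (`mem_cmLocus_snd`), `pr₁^* c` has rational `(p,p)` restrictions on every fibre, every fibre is good (part XXXI-d
  `forall_good_of_not_countable_good`), so `pr₁^* c` is algebraic on the fibre over the origin, i.e. `c` is algebraic
  (`mem_algebraicClasses_of_map_fiberι_map_fst_of_eq`, ab-spread-1).
* §2 `cmFibreAlgebraicLift_of_forall_not_countable_good_of_verdier` — Good_ℵ ⟹ (L) [Verdier] (part XXXI-d §2 at the CM points);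
  **`HC_AV_of_andre1996_of_forall_not_countable_good_of_verdier`** — `h₂₁ → hGT → Good_ℵ → HC_AV` with NO `HC_CM` hypothesis;
  **`HC_AV_iff_forall_not_countable_good_of_andre1996_of_verdier`** — `HC_AV ⟺ Good_ℵ` modulo [h₂₁, hGT]: a PIVOT;
  `forall_not_countable_good_of_HC_AV_of_verdier` (on-path converse).

EDGE LABELS: §1 fact-free; §2 K[Verdier] / K[6.3.1, Verdier]. No `def`, no `sorry`; axioms standard.

References: Andre1996Motifs (§6.3 footnote (2) p. 31, Lemme 6.3.1, Remarque 2 p. 33); Verdier1976 (Cor. (5.1));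
CharlesSchnell2014Notes (Prop. 11.3.11, Cor. 11.3.6); Deligne1982HodgeCycles (§6); Fulton1998 (§10.1); SilvermanAEC2009 (VI.4.1).
-/

noncomputable section

set_option linter.dupNamespace false

namespace Summit.HodgeConjecture.HodgeConjecture.Ring2.AbelianAll

open CategoryTheory AlgebraicGeometry MonoidalCategory
open Literature.AlgebraicGeometry Literature.AlgebraicGeometry.Motives
open Literature.AlgebraicGeometry.HodgeTheory
open Literature.AlgebraicGeometry.Deligne1982 (cmLocus)
open Literature.AlgebraicGeometry.Milne1999 (IsOfCMType)
open Literature.NumberTheory.EllipticCurves (CMEndomorphism.exists_cmCurve_sqrt_neg)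
open Literature.AlgebraicGeometry.Andre1996 (andre1996_cmAnchoredPencil)
open Summit.HodgeConjecture.HodgeConjecture
open Summit.HodgeConjecture.HodgeConjecture.Theses
open Summit.HodgeConjecture.HodgeConjecture.Ring2.Deform (HC_CM_of_HC_AV)

/-! ## §1 Good_ℵ contains `HC_CM` (constant pencils; no named fact) -/

/-- **Good_ℵ ⟹ `HC_CM`, with NO named fact.** If on every CM-pointed compact pencil of abelian varieties the `p`-good fibres are
uncountably many (every `p`), then every rational `(p,p)` class on every CM abelian variety `A` is algebraic: run the hypothesis
on the constant pencil `A × E₀ ⟶ E₀` through the tree's CM elliptic curve `E₀`, all of whose fibres are CM; every fibre is then good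
(part XXXI-d §1), so `pr₁^* c` — whose fibre restrictions are the rational `(p,p)` classes `(e_s⁻¹)^* c` — is algebraic on the fibre
over the origin, and the slice chart carries this back to `c` (ab-spread-1's `mem_algebraicClasses_of_map_fiberι_map_fst_of_eq`).
[cite: Andre1996Motifs, §6.3 footnote (2) (p. 31)] [cite: CharlesSchnell2014Notes, Prop. 11.3.11 (proof)] [cite: Fulton1998, §10.1] -/
theorem HC_CM_of_forall_not_countable_good
    (hG : ∀ ⦃d : ℕ⦄ ⦃𝒳 S : SchemeOver ℂ⦄ (f : 𝒳 ⟶ S), IsCompactAbelianPencil f d → (cmLocus f d).Nonempty → ∀ p : ℕ,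
      ¬ {s : ComplexPoints S | ∀ W : complexBetti 𝒳 (2 * p),
          (∀ s' : ComplexPoints S, IsRationalClass (complexBetti.map (fiberι f s') (2 * p) W) ∧
            IsOfHodgeType d (fiberOver f s') (2 * p) p p (complexBetti.map (fiberι f s') (2 * p) W)) →
          complexBetti.map (fiberι f s) (2 * p) W ∈ algebraicClasses (fiberOver f s) p}.Countable) :
    RankFourFaces.CMAbelianHodge := by
  intro A hA hAcm
  refine (hodgeConjectureFor_iff_of_isSmoothProjective nonempty_hodgeModel_holds hA).2 fun p c hc hpp ↦ ?_
  obtain ⟨E₀, ψ₀, hE₀, -⟩ := CMEndomorphism.exists_cmCurve_sqrt_neg 1 one_pos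
  have hf : IsCompactAbelianPencil (CartesianMonoidalCategory.snd A.X E₀.X) A.dim :=
    isCompactAbelianPencil_snd A (isSmoothProjective_of_dim_eq' hE₀)
  obtain ⟨e, he⟩ := exists_sliceFiberIso A.X (C := E₀.X) (1 : E₀.Points ℂ)
  refine mem_algebraicClasses_of_map_fiberι_map_fst_of_eq A he ?_
  refine forall_good_of_not_countable_good hf p (hG _ hf ⟨_, mem_cmLocus_snd A hAcm (1 : E₀.Points ℂ)⟩ p)
    (1 : E₀.Points ℂ) (complexBetti.map (CartesianMonoidalCategory.fst A.X E₀.X) (2 * p) c) fun s' ↦ ?_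
  rw [← CategoryTheory.comp_apply, ← complexBetti.map_comp]
  exact ⟨hc.pullback _, hpp.map_of_isSmoothProjective (hf.isSmoothProjective_fiberOver s') hA _⟩

/-! ## §2 Good_ℵ is a pivot: `HC_AV ⟺ Good_ℵ` modulo [Lemme 6.3.1, Verdier] -/

/-- **Good_ℵ ⟹ (L), granted Verdier** (part XXXI-d `comap_le_sup_of_not_countable_good_of_verdier` at the CM points, in the lattice
form of part XVII-b). [cite: Verdier1976, Cor. (5.1)] [cite: Andre1996Motifs, §5.1 (p. 25) and §6.3 a) (p. 33)] -/
theorem cmFibreAlgebraicLift_of_forall_not_countable_good_of_verdier (hGT : Verdier1976_genericLocalTriviality)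
    (hG : ∀ ⦃d : ℕ⦄ ⦃𝒳 S : SchemeOver ℂ⦄ (f : 𝒳 ⟶ S), IsCompactAbelianPencil f d → (cmLocus f d).Nonempty → ∀ p : ℕ,
      ¬ {s : ComplexPoints S | ∀ W : complexBetti 𝒳 (2 * p),
          (∀ s' : ComplexPoints S, IsRationalClass (complexBetti.map (fiberι f s') (2 * p) W) ∧
            IsOfHodgeType d (fiberOver f s') (2 * p) p p (complexBetti.map (fiberι f s') (2 * p) W)) →
          complexBetti.map (fiberι f s) (2 * p) W ∈ algebraicClasses (fiberOver f s) p}.Countable) :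
    CMFibreAlgebraicLift :=
  cmFibreAlgebraicLift_iff_comap_le_sup.2 fun _ _ _ f hf p t ht ↦
    comap_le_sup_of_not_countable_good_of_verdier hGT hf p (hG f hf ⟨t, ht⟩ p) t

/-- **`h₂₁ → hGT → Good_ℵ → HC_AV` with NO `HC_CM` hypothesis** (Good_ℵ supplies both `HC_CM`, §1, and (L), above; part I's
`HC_AV_of_HC_CM_and_cmFibreAlgebraicLift`). `h₂₁`, `hGT` binders. research route, not a corollary; conditional on HC_CM plus one
named minimal statement. [cite: Andre1996Motifs, Lemme 6.3.1 (p. 31) and Remarque 2 (p. 33)] [cite: Verdier1976, Cor. (5.1)] -/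
theorem HC_AV_of_andre1996_of_forall_not_countable_good_of_verdier (h₂₁ : andre1996_cmAnchoredPencil)
    (hGT : Verdier1976_genericLocalTriviality)
    (hG : ∀ ⦃d : ℕ⦄ ⦃𝒳 S : SchemeOver ℂ⦄ (f : 𝒳 ⟶ S), IsCompactAbelianPencil f d → (cmLocus f d).Nonempty → ∀ p : ℕ,
      ¬ {s : ComplexPoints S | ∀ W : complexBetti 𝒳 (2 * p),
          (∀ s' : ComplexPoints S, IsRationalClass (complexBetti.map (fiberι f s') (2 * p) W) ∧
            IsOfHodgeType d (fiberOver f s') (2 * p) p p (complexBetti.map (fiberι f s') (2 * p) W)) →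
          complexBetti.map (fiberι f s) (2 * p) W ∈ algebraicClasses (fiberOver f s) p}.Countable) :
    PadicSemiregularLift.HodgeAbelianVarieties :=
  HC_AV_of_HC_CM_and_cmFibreAlgebraicLift h₂₁ (HC_CM_of_forall_not_countable_good hG)
    (cmFibreAlgebraicLift_of_forall_not_countable_good_of_verdier hGT hG)

/-- **ON-PATH converse: `HC_AV ⟹ Good_ℵ`, granted Verdier** (`HC_AV` gives `HC_CM` and (L) — part XI — and part XXXI-d reads (L) at a
CM point as "uncountably many good fibres"). [cite: Verdier1976, Cor. (5.1)] [cite: CharlesSchnell2014Notes, Cor. 11.3.6] -/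
theorem forall_not_countable_good_of_HC_AV_of_verdier (hGT : Verdier1976_genericLocalTriviality)
    (h : PadicSemiregularLift.HodgeAbelianVarieties) :
    ∀ ⦃d : ℕ⦄ ⦃𝒳 S : SchemeOver ℂ⦄ (f : 𝒳 ⟶ S), IsCompactAbelianPencil f d → (cmLocus f d).Nonempty → ∀ p : ℕ,
      ¬ {s : ComplexPoints S | ∀ W : complexBetti 𝒳 (2 * p),
          (∀ s' : ComplexPoints S, IsRationalClass (complexBetti.map (fiberι f s') (2 * p) W) ∧
            IsOfHodgeType d (fiberOver f s') (2 * p) p p (complexBetti.map (fiberι f s') (2 * p) W)) →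
          complexBetti.map (fiberι f s) (2 * p) W ∈ algebraicClasses (fiberOver f s) p}.Countable := by
  intro d 𝒳 S f hf hne p
  obtain ⟨t, ht⟩ := hne
  exact (comap_le_sup_iff_not_countable_good_of_HC_CM_of_verdier hGT (HC_CM_of_HC_AV h) hf p ht).1
    (cmFibreAlgebraicLift_iff_comap_le_sup.1 (cmFibreAlgebraicLift_of_HC_AV_of_verdier hGT h) f hf p t ht)

/-- **PIVOT: `HC_AV ⟺ Good_ℵ` modulo [Lemme 6.3.1, Verdier]** — "uncountably many good fibres on every CM-pointed compact pencil of abelian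
varieties" is EQUIVALENT to the Hodge conjecture for all abelian varieties and already contains `HC_CM` (§1): KIND 1, not an `HC_CM`-idle
complement (that role is (4_ℵ)'s, part XXXI-b). `h₂₁`, `hGT` binders. [cite: Andre1996Motifs, Lemme 6.3.1 (p. 31) and Remarque 2 (p. 33)]
[cite: Verdier1976, Cor. (5.1)] -/
theorem HC_AV_iff_forall_not_countable_good_of_andre1996_of_verdier (h₂₁ : andre1996_cmAnchoredPencil)
    (hGT : Verdier1976_genericLocalTriviality) :
    PadicSemiregularLift.HodgeAbelianVarieties ↔
      ∀ ⦃d : ℕ⦄ ⦃𝒳 S : SchemeOver ℂ⦄ (f : 𝒳 ⟶ S), IsCompactAbelianPencil f d → (cmLocus f d).Nonempty → ∀ p : ℕ,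
        ¬ {s : ComplexPoints S | ∀ W : complexBetti 𝒳 (2 * p),
            (∀ s' : ComplexPoints S, IsRationalClass (complexBetti.map (fiberι f s') (2 * p) W) ∧
              IsOfHodgeType d (fiberOver f s') (2 * p) p p (complexBetti.map (fiberι f s') (2 * p) W)) →
            complexBetti.map (fiberι f s) (2 * p) W ∈ algebraicClasses (fiberOver f s) p}.Countable :=
  ⟨forall_not_countable_good_of_HC_AV_of_verdier hGT, HC_AV_of_andre1996_of_forall_not_countable_good_of_verdier h₂₁ hGT⟩

end Summit.HodgeConjecture.HodgeConjecture.Ring2.AbelianAll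

end
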